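import Literature.Topology.FourManifolds.PlanarConvexFamily
import HarnessLib

/-!
# Planar families in a band: convex combination of two tracks with antitone abscissae

Topic `Literature/Topology/FourManifolds`; fact seat `provefact-IsStrictHandleSlide.isSurgery`
(R. C. Kirby, *The Topology of 4-Manifolds*, LNM 1374 (1989), Ch. I §4; remaining content: the
named fact (S) `Literature.Topology.FourManifolds.FramedLink.IsStrictHandleSlide.slideModel`).
Mirror of `PlanarConvexFamily.lean` for tracks whose first coordinates are *non-increasing* (the
upper arch of the rebuilt attaching circle runs from the push-off back to `A`, `x₀` decreasing):
same statements and proofs with the inequalities on the abscissae reversed. Proved here (no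
definitions, no named facts):

* `convexTrack_injOn_antitone`, `convexTrack_deriv_ne_zero_antitone`,
  `BandData.planarFamily_convex_antitone`.

## References

* R. C. Kirby, *The Topology of 4-Manifolds*, LNM 1374, Springer (1989), Ch. I §4. [Kirby1989]
* M. W. Hirsch, *Differential Topology* (1976), Ch. 8 §1, Thm. 1.3. [HirschDT1976]
-/

open scoped Manifold ContDiff Topology
open Function Set Metric

noncomputable section

namespace Literature.Topology.FourManifolds

/-- **Injectivity of convex combinations of two antitone-abscissa tracks.** Let `X₀, X₁` be
antitone on `S = [s₁, s₂]`, let the two tracks `(X₀, H₀)`, `(X₁, H₁)` be injective on `S`, and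
suppose that whenever `t < t'` in `S` with `X₀ t = X₀ t'` and `X₁ t = X₁ t'` the heights are
strictly ordered the same way (`H₀ t < H₀ t' ∧ H₁ t < H₁ t'` or `H₀ t' < H₀ t ∧ H₁ t' < H₁ t`).
Then for every `u ∈ [0, 1]` the track `t ↦ ((1-u) X₀ t + u X₁ t, (1-u) H₀ t + u H₁ t)` is
injective on `S`. [folklore] -/
theorem convexTrack_injOn_antitone {X₀ X₁ H₀ H₁ : ℝ → ℝ} {s₁ s₂ : ℝ}
    (hX₀ : AntitoneOn X₀ (Icc s₁ s₂)) (hX₁ : AntitoneOn X₁ (Icc s₁ s₂))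
    (h₀ : InjOn (fun t ↦ (pt2 (X₀ t) (H₀ t) : EuclideanSpace ℝ (Fin 2))) (Icc s₁ s₂))
    (h₁ : InjOn (fun t ↦ (pt2 (X₁ t) (H₁ t) : EuclideanSpace ℝ (Fin 2))) (Icc s₁ s₂))
    (hco : ∀ t ∈ Icc s₁ s₂, ∀ t' ∈ Icc s₁ s₂, t < t' → X₀ t = X₀ t' → X₁ t = X₁ t' →
      (H₀ t < H₀ t' ∧ H₁ t < H₁ t') ∨ (H₀ t' < H₀ t ∧ H₁ t' < H₁ t))
    {u : ℝ} (hu : u ∈ Icc (0 : ℝ) 1) :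
    InjOn (fun t ↦ (pt2 ((1 - u) * X₀ t + u * X₁ t) ((1 - u) * H₀ t + u * H₁ t) : EuclideanSpace ℝ (Fin 2)))
      (Icc s₁ s₂) := by
  -- reduce to `t < t'`
  suffices key : ∀ t ∈ Icc s₁ s₂, ∀ t' ∈ Icc s₁ s₂, t < t' →
      (pt2 ((1 - u) * X₀ t + u * X₁ t) ((1 - u) * H₀ t + u * H₁ t) : EuclideanSpace ℝ (Fin 2)) ≠
        pt2 ((1 - u) * X₀ t' + u * X₁ t') ((1 - u) * H₀ t' + u * H₁ t') by
    intro t ht t' ht' he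
    rcases lt_trichotomy t t' with hlt | heq | hgt
    · exact absurd he (key t ht t' ht' hlt)
    · exact heq
    · exact absurd he.symm (key t' ht' t ht hgt)
  intro t ht t' ht' hlt he
  have hx : (1 - u) * X₀ t + u * X₁ t = (1 - u) * X₀ t' + u * X₁ t' := congrArg (fun w : EuclideanSpace ℝ (Fin 2) ↦ w 0) he
  have hh : (1 - u) * H₀ t + u * H₁ t = (1 - u) * H₀ t' + u * H₁ t' := congrArg (fun w : EuclideanSpace ℝ (Fin 2) ↦ w 1) he
  have hm₀ := hX₀ ht ht' hlt.le
  have hm₁ := hX₁ ht ht' hlt.le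
  rcases hu.1.eq_or_lt with hu0 | hu0
  · -- `u = 0`: the first track
    subst hu0
    simp only [sub_zero, one_mul, zero_mul, add_zero] at hx hh
    have := h₀ ht ht' (show (pt2 (X₀ t) (H₀ t) : EuclideanSpace ℝ (Fin 2)) = pt2 (X₀ t') (H₀ t') by rw [hx, hh])
    exact hlt.ne this
  rcases hu.2.eq_or_lt with hu1 | hu1
  · -- `u = 1`: the second track
    subst hu1
    simp only [sub_self, zero_mul, one_mul, zero_add] at hx hh
    have := h₁ ht ht' (show (pt2 (X₁ t) (H₁ t) : EuclideanSpace ℝ (Fin 2)) = pt2 (X₁ t') (H₁ t') by rw [hx, hh])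
    exact hlt.ne this
  · -- `0 < u < 1`: both abscissae are stationary, the heights separate
    have he₀ : X₀ t = X₀ t' := by nlinarith
    have he₁ : X₁ t = X₁ t' := by nlinarith
    rcases hco t ht t' ht' hlt he₀ he₁ with ⟨ha, hb⟩ | ⟨ha, hb⟩ <;> nlinarith

/-- **Regularity of convex combinations (antitone abscissae).** If at `s` both abscissa derivatives are `≤ 0`, the two
tracks are regular at `s`, and whenever both abscissa derivatives vanish the height derivatives are
nonzero of the same sign, then every intermediate track is regular at `s`. [folklore] -/
theorem convexTrack_deriv_ne_zero_antitone {X₀ X₁ H₀ H₁ : ℝ → ℝ} {s : ℝ}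
    (hdX₀ : DifferentiableAt ℝ X₀ s) (hdX₁ : DifferentiableAt ℝ X₁ s)
    (hdH₀ : DifferentiableAt ℝ H₀ s) (hdH₁ : DifferentiableAt ℝ H₁ s)
    (hX₀ : deriv X₀ s ≤ 0) (hX₁ : deriv X₁ s ≤ 0)
    (h₀ : deriv X₀ s = 0 → deriv H₀ s ≠ 0) (h₁ : deriv X₁ s = 0 → deriv H₁ s ≠ 0)
    (hco : deriv X₀ s = 0 → deriv X₁ s = 0 → 0 < deriv H₀ s * deriv H₁ s)
    {u : ℝ} (hu : u ∈ Icc (0 : ℝ) 1) :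
    deriv (fun t ↦ (pt2 ((1 - u) * X₀ t + u * X₁ t) ((1 - u) * H₀ t + u * H₁ t) : EuclideanSpace ℝ (Fin 2))) s ≠ 0 := by
  have hx : HasDerivAt (fun t ↦ (1 - u) * X₀ t + u * X₁ t) ((1 - u) * deriv X₀ s + u * deriv X₁ s) s :=
    (hdX₀.hasDerivAt.const_mul _).add (hdX₁.hasDerivAt.const_mul _)
  have hh : HasDerivAt (fun t ↦ (1 - u) * H₀ t + u * H₁ t) ((1 - u) * deriv H₀ s + u * deriv H₁ s) s :=
    (hdH₀.hasDerivAt.const_mul _).add (hdH₁.hasDerivAt.const_mul _)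
  rw [(hasDerivAt_pt2 hx hh).deriv]
  intro h
  have e0 : (1 - u) * deriv X₀ s + u * deriv X₁ s = 0 := congrArg (fun w : EuclideanSpace ℝ (Fin 2) ↦ w 0) h
  have e1 : (1 - u) * deriv H₀ s + u * deriv H₁ s = 0 := congrArg (fun w : EuclideanSpace ℝ (Fin 2) ↦ w 1) h
  rcases hu.1.eq_or_lt with hu0 | hu0
  · subst hu0
    simp only [sub_zero, one_mul, zero_mul, add_zero] at e0 e1
    exact h₀ e0 e1
  rcases hu.2.eq_or_lt with hu1 | hu1
  · subst hu1
    simp only [sub_self, zero_mul, one_mul, zero_add] at e0 e1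
    exact h₁ e0 e1
  · have d0 : deriv X₀ s = 0 := by nlinarith
    have d1 : deriv X₁ s = 0 := by nlinarith
    have hp := hco d0 d1
    -- `(1-u) a + u b = 0` with `a b > 0`, `0 < u < 1` is impossible
    rcases lt_or_gt_of_ne (h₀ d0) with ha | ha
    · have hb : deriv H₁ s < 0 := by
        by_contra hb; push Not at hb; nlinarith
      nlinarith
    · have hb : 0 < deriv H₁ s := by
        by_contra hb; push Not at hb; nlinarith
      nlinarith


namespace BandData

variable {A B k : Knot} {avoid : Set (Metric.sphere (0 : EuclideanSpace ℝ (Fin 4)) 1)}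
  (b : BandData A B k avoid)

/-- **The convex-combination planar family (antitone abscissae).** Two smooth tracks `(X₀, H₀)` (the given piece of
the knot `k₀` over `S = [s₁, s₂]`, `k₀.curve s = band (X₀ s, H₀ s)`) and `(X₁, H₁)`, agreeing off
the inner interval `(s₁', s₂')`, both inside the square neighbourhood and injective-regular on `S`,
with monotone abscissae and co-monotone heights on common plateaux (and co-signed height
derivatives at common stationary points), whose convex combinations stay off the rest of `k₀`:
then `P u t = ((1-u) X₀ t + u X₁ t, (1-u) H₀ t + u H₁ t)` is a planar family for `k₀`.
[cite: HirschDT1976, Ch. 8 §1, Thm. 1.3] -/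
theorem planarFamily_convex_antitone {k₀ : Knot} {a ε s₁ s₁' s₂' s₂ : ℝ} {X₀ X₁ H₀ H₁ : ℝ → ℝ}
    (hε : 0 < ε) (hs : a + ε ≤ s₁ ∧ s₁ < s₁' ∧ s₁' < s₂' ∧ s₂' < s₂ ∧ s₂ ≤ a + 1 - ε)
    (hX₀s : ContDiff ℝ ∞ X₀) (hX₁s : ContDiff ℝ ∞ X₁) (hH₀s : ContDiff ℝ ∞ H₀) (hH₁s : ContDiff ℝ ∞ H₁)
    (hagreeX : ∀ t, t ∉ Ioo s₁' s₂' → X₁ t = X₀ t) (hagreeH : ∀ t, t ∉ Ioo s₁' s₂' → H₁ t = H₀ t)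
    (hcurve : ∀ s ∈ Icc s₁ s₂, Knot.curve k₀ s = ((b.band (pt2 (X₀ s) (H₀ s)) : Metric.sphere (0 : EuclideanSpace ℝ (Fin 4)) 1) :
      EuclideanSpace ℝ (Fin 4)))
    (hmem₀ : ∀ s ∈ Icc s₁ s₂, (pt2 (X₀ s) (H₀ s) : EuclideanSpace ℝ (Fin 2)) ∈ squareNhd b.δ)
    (hmem₁ : ∀ s ∈ Icc s₁ s₂, (pt2 (X₁ s) (H₁ s) : EuclideanSpace ℝ (Fin 2)) ∈ squareNhd b.δ)
    (hdX₀ : ∀ s ∈ Icc s₁ s₂, deriv X₀ s ≤ 0) (hdX₁ : ∀ s ∈ Icc s₁ s₂, deriv X₁ s ≤ 0)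
    (hinj₀ : InjOn (fun t ↦ (pt2 (X₀ t) (H₀ t) : EuclideanSpace ℝ (Fin 2))) (Icc s₁ s₂))
    (hinj₁ : InjOn (fun t ↦ (pt2 (X₁ t) (H₁ t) : EuclideanSpace ℝ (Fin 2))) (Icc s₁ s₂))
    (hco : ∀ t ∈ Icc s₁ s₂, ∀ t' ∈ Icc s₁ s₂, t < t' → X₀ t = X₀ t' → X₁ t = X₁ t' →
      (H₀ t < H₀ t' ∧ H₁ t < H₁ t') ∨ (H₀ t' < H₀ t ∧ H₁ t' < H₁ t))
    (hreg₀ : ∀ s ∈ Icc s₁ s₂, deriv X₀ s = 0 → deriv H₀ s ≠ 0)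
    (hreg₁ : ∀ s ∈ Icc s₁ s₂, deriv X₁ s = 0 → deriv H₁ s ≠ 0)
    (hcoD : ∀ s ∈ Icc s₁ s₂, deriv X₀ s = 0 → deriv X₁ s = 0 → 0 < deriv H₀ s * deriv H₁ s)
    (hdisj : ∀ u ∈ Icc (0 : ℝ) 1, ∀ s ∈ Icc s₁ s₂, ∀ t ∈ Ico a (a + 1), t ∉ Icc s₁ s₂ →
      ((b.band (pt2 ((1 - u) * X₀ s + u * X₁ s) ((1 - u) * H₀ s + u * H₁ s)) : Metric.sphere (0 : EuclideanSpace ℝ (Fin 4)) 1) :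
        EuclideanSpace ℝ (Fin 4)) ≠ Knot.curve k₀ t) :
    b.PlanarFamily k₀ a ε s₁ s₁' s₂' s₂
      (fun u t ↦ pt2 ((1 - u) * X₀ t + u * X₁ t) ((1 - u) * H₀ t + u * H₁ t)) := by
  -- antitonicity of the abscissae from the sign of their derivatives
  have hmono : ∀ {X : ℝ → ℝ}, ContDiff ℝ ∞ X → (∀ s ∈ Icc s₁ s₂, deriv X s ≤ 0) → AntitoneOn X (Icc s₁ s₂) :=
    fun {X} hXs hd ↦ antitoneOn_of_deriv_nonpos (convex_Icc s₁ s₂) hXs.continuous.continuousOn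
      (fun x _ ↦ ((hXs.differentiable (by simp)) x).differentiableWithinAt)
      (fun x hx ↦ hd x (interior_subset hx))
  have hX₀ := hmono hX₀s hdX₀
  have hX₁ := hmono hX₁s hdX₁
  have hPs : ContDiff ℝ ∞ (uncurry fun u t ↦ (pt2 ((1 - u) * X₀ t + u * X₁ t) ((1 - u) * H₀ t + u * H₁ t) : EuclideanSpace ℝ (Fin 2))) := by
    have hu : ContDiff ℝ ∞ fun p : ℝ × ℝ ↦ p.1 := contDiff_fst
    have hx : ContDiff ℝ ∞ fun p : ℝ × ℝ ↦ (1 - p.1) * X₀ p.2 + p.1 * X₁ p.2 :=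
      ((contDiff_const.sub hu).mul (hX₀s.comp contDiff_snd)).add (hu.mul (hX₁s.comp contDiff_snd))
    have hh : ContDiff ℝ ∞ fun p : ℝ × ℝ ↦ (1 - p.1) * H₀ p.2 + p.1 * H₁ p.2 :=
      ((contDiff_const.sub hu).mul (hH₀s.comp contDiff_snd)).add (hu.mul (hH₁s.comp contDiff_snd))
    rw [show (uncurry fun u t ↦ (pt2 ((1 - u) * X₀ t + u * X₁ t) ((1 - u) * H₀ t + u * H₁ t) : EuclideanSpace ℝ (Fin 2))) =
      fun p : ℝ × ℝ ↦ pt2 ((1 - p.1) * X₀ p.2 + p.1 * X₁ p.2) ((1 - p.1) * H₀ p.2 + p.1 * H₁ p.2) from rfl]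
    rw [contDiff_euclidean]
    intro i; fin_cases i
    · exact hx
    · exact hh
  refine
    { ε_pos := hε
      hs := hs
      contDiff := hPs
      eq_zero := fun u t ht ↦ ?_
      curve_eq := fun s hss ↦ ?_
      mem := fun u hu s hss ↦ ?_
      deriv_ne := fun u hu s hss ↦ ?_
      injOn := fun u hu ↦ convexTrack_injOn_antitone hX₀ hX₁ hinj₀ hinj₁ hco hu
      disjoint := hdisj }
  · -- off the inner interval both tracks agree
    simp only [hagreeX t ht, hagreeH t ht]
    congr 1 <;> ring
  · simp only [sub_zero, one_mul, zero_mul, add_zero]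
    exact hcurve s hss
  · -- the square neighbourhood is convex in each coordinate
    have h0 := hmem₀ s hss
    have h1 := hmem₁ s hss
    rw [mem_squareNhd_iff] at h0 h1 ⊢
    intro i
    fin_cases i
    · have a := h0 0; have c := h1 0
      change X₀ s ∈ Ioo (-b.δ) (1 + b.δ) at a
      change X₁ s ∈ Ioo (-b.δ) (1 + b.δ) at c
      show (1 - u) * X₀ s + u * X₁ s ∈ Ioo (-b.δ) (1 + b.δ)
      exact convex_mem_Ioo a c hu
    · have a := h0 1; have c := h1 1
      change H₀ s ∈ Ioo (-b.δ) (1 + b.δ) at a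
      change H₁ s ∈ Ioo (-b.δ) (1 + b.δ) at c
      show (1 - u) * H₀ s + u * H₁ s ∈ Ioo (-b.δ) (1 + b.δ)
      exact convex_mem_Ioo a c hu
  · exact convexTrack_deriv_ne_zero_antitone ((hX₀s.differentiable (by simp)) s) ((hX₁s.differentiable (by simp)) s)
      ((hH₀s.differentiable (by simp)) s) ((hH₁s.differentiable (by simp)) s) (hdX₀ s hss) (hdX₁ s hss)
      (hreg₀ s hss) (hreg₁ s hss) (hcoD s hss) hu

end BandData

end Literature.Topology.FourManifolds
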